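import Summits.Ventures.YMGap.FlowData.SecondOrderTailCertificate
import Literature.Analysis.InnerProduct.CourantFischerBounds

/-!
# Venture YMGap, track Y3 FLOW-DATA — the x2r second-order tail certificate, spectral form (file 3)

HONEST FRAMING: venture file of the cell `pub-ymgap`, track Y3; companion of `FlowData/SecondOrderTailCertificate.lean`
(files 1–2 carry the story).  There the second-order tail bound (TB) of lineage C is proved for an EIGENPAIR `T x = λ x` and a
unit TOP EIGENVECTOR `u₀` of the kept block given as hypotheses.  Here those two existence statements are discharged by the
spectral theorem on a finite-dimensional real inner product space (Mathlib's `LinearMap.IsSymmetric.eigenvectorBasis`,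
antitone `eigenvalues`, and the tree's one-sided Rayleigh bound `re_inner_apply_self_le_of_inner_eq_zero`):

* `isSymmetric_keptBlock` — `(1 − Q) T (1 − Q)` is symmetric; the kept block enters the theorems below as ANY symmetric `A` with
  `A a = T (a − Q a) − Q (T (a − Q a))` (for a matrix: `toEuclideanLin` of its kept-set compression, whose `eigenvalues` ARE Mathlib's
  `Matrix.IsHermitian.eigenvalues₀` by definition); `inner_le_top_eigenvalue`, `top_keptBlock_le_top` — `⟨w, T w⟩ ≤ λ↓₀(T)‖w‖²` and
  `λ↓₀(A) ≤ λ↓₀(T)` for `T ⪰ 0` (so `ℓ := μ_lo` is admissible below);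
* `x2r_eigenvalue_bound` — for `T ⪰ 0` symmetric, `Q` a symmetric idempotent with `Q T Q ⪯ ε` (`0 ≤ ε < ℓ ≤ λ↓₀(T)`), the kept
  block `⪯ Λ` on `ker Q`, its sorted eigenvalues `μ↓₀ ∈ [μ_lo, μ_up]`, `μ↓₁ ≤ ℓ₁` (`ℓ₁ ≥ 0`), a unit kept vector `v` with
  `ρ = ⟨v, T v⟩ > ℓ₁`, `r = ‖(1 − Q) T v − ρ v‖`, `X^{1/2} = ‖Q T v‖`, `γ = εΛ/(ℓ − ε)`, `η = √2·r/(ρ − ℓ₁)`, `μ_lo − ℓ₁ − γ > 0`: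
  `λ↓₀(T) ≤ μ_up + (X^{1/2} + (εΛ)^{1/2} η)²/(ℓ − ε) · (1 + γ/(μ_lo − ℓ₁ − γ))` — the x2r upper endpoint `U_B` of
  `x2r_cert.py` with `Λ = 1`, now as a statement about Mathlib's top eigenvalue.  The sign choice `⟨u₀, v⟩ ≥ 0` of file 2
  is made inside the proof (`u₀ ↦ −u₀`).

MATRIX READING (no extra theorem needed): for a real symmetric `M : Matrix m m ℝ` and a kept predicate `p` take
`E := EuclideanSpace ℝ m`, `hn := finrank_euclideanSpace`, `T := Matrix.toEuclideanLin M`, `Q := Matrix.toEuclideanLin (1 − P)`,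
`A := Matrix.toEuclideanLin (P * M * P)` with `P = diagonal (if p · then 1 else 0)`; then `hT.eigenvalues hn` and `hA.eigenvalues hn` ARE
`Matrix.IsHermitian.eigenvalues₀` of `M` and of `P M P` (Mathlib's definition, `rfl`), i.e. the sorted lists the certificate encloses
(`OstrowskiWeylRecord.eigenvalues₀_mem_Icc_record` for lineage C's blocks).

Pure finite-dimensional linear algebra; no matrix entries, no number, no row; the interval arithmetic producing `ℓ`, `ℓ₁`,
`μ_lo`, `μ_up`, `r`, `X` (binary128 kernel + Ostrowski–Weyl certificate) stays outside, as hypotheses.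
References: Y. Saad, *Numerical Methods for Large Eigenvalue Problems* (1992), Ch. III Thm 3.8/3.9 [cite: Saad1992, Ch. III
Thm 3.8]; R. A. Horn, C. R. Johnson, *Matrix Analysis* (2013), Thm 4.2.6 (Courant–Fischer), Thm 7.7.7 [cite: HornJohnson2013,
Thm 4.2.6; Thm 7.7.7]; the cell's X2R-METHOD.md / FLOW-REFEREE.md FR-156.
-/

noncomputable section

open scoped InnerProductSpace
open RealInnerProductSpace Module

namespace Summit.Ventures.YMGap.FlowData

namespace SecondOrderTail

open Literature.Analysis.InnerProduct

variable {E : Type*} [NormedAddCommGroup E] [InnerProductSpace ℝ E]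

/-- The kept block `(1 − Q) T (1 − Q)` of a symmetric `T` for a symmetric `Q` is symmetric. [folklore] -/
theorem isSymmetric_keptBlock {T Q : E →ₗ[ℝ] E} (hT : T.IsSymmetric) (hQs : ∀ x y : E, ⟪Q x, y⟫ = ⟪x, Q y⟫) :
    ((LinearMap.id - Q) ∘ₗ T ∘ₗ (LinearMap.id - Q)).IsSymmetric := by
  have hPs : ∀ x y : E, ⟪((LinearMap.id : E →ₗ[ℝ] E) - Q) x, y⟫ = ⟪x, ((LinearMap.id : E →ₗ[ℝ] E) - Q) y⟫ := by
    intro x y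
    simp only [LinearMap.sub_apply, LinearMap.id_apply, inner_sub_left, inner_sub_right, hQs]
  intro x y
  simp only [LinearMap.comp_apply]
  rw [hPs, hT, hPs]

variable [FiniteDimensional ℝ E] {n : ℕ}

/-- Rayleigh bound at the top: `⟨w, T w⟩ ≤ λ↓₀(T) ‖w‖²` (Courant–Fischer at index `0`). [cite: HornJohnson2013, Thm 4.2.6] -/
theorem inner_le_top_eigenvalue (hn : finrank ℝ E = n) (hn0 : 0 < n) {T : E →ₗ[ℝ] E} (hT : T.IsSymmetric) (w : E) :
    ⟪w, T w⟫ ≤ hT.eigenvalues hn ⟨0, hn0⟩ * ‖w‖ ^ 2 := by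
  have h := re_inner_apply_self_le_of_inner_eq_zero hT hn ⟨0, hn0⟩ (x := w) (fun i hi => absurd hi (Nat.not_lt_zero _))
  rw [RCLike.re_to_real, real_inner_comm] at h
  exact h

/-- The top of the kept block is below the top of `T ⪰ 0`: if `A` is symmetric with `A a = T (a − Q a) − Q (T (a − Q a))`
(`A = (1 − Q) T (1 − Q)`, e.g. `toEuclideanLin` of the kept-set compression of a matrix) then `λ↓₀(A) ≤ λ↓₀(T)` — so the
certificate may take `ℓ := μ_lo` (any certified lower bound of the kept-block top) in `x2r_eigenvalue_bound`.
[cite: HornJohnson2013, Thm 4.2.6] -/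
theorem top_keptBlock_le_top (hn : finrank ℝ E = n) (hn0 : 0 < n) {T Q A : E →ₗ[ℝ] E} (hT : T.IsSymmetric)
    (hpos : ∀ z : E, 0 ≤ ⟪z, T z⟫) (hQs : ∀ x y : E, ⟪Q x, y⟫ = ⟪x, Q y⟫) (hQi : ∀ x : E, Q (Q x) = Q x)
    (hA : A.IsSymmetric) (hAeq : ∀ a : E, A a = T (a - Q a) - Q (T (a - Q a))) :
    hA.eigenvalues hn ⟨0, hn0⟩ ≤ hT.eigenvalues hn ⟨0, hn0⟩ := by
  set u := hA.eigenvectorBasis hn ⟨0, hn0⟩ with hudef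
  have hAu : A u = (hA.eigenvalues hn ⟨0, hn0⟩) • u := hA.apply_eigenvectorBasis hn ⟨0, hn0⟩
  have hu1 : ‖u‖ = 1 := (hA.eigenvectorBasis hn).orthonormal.1 ⟨0, hn0⟩
  have hPs : ∀ x y : E, ⟪x - Q x, y⟫ = ⟪x, y - Q y⟫ := by
    intro x y; rw [inner_sub_left, inner_sub_right, hQs]
  -- λ↓₀(A) = ⟨u, A u⟩ = ⟨u − Q u, T (u − Q u)⟩ ≤ λ↓₀(T) ‖u − Q u‖² ≤ λ↓₀(T)
  have h1 : hA.eigenvalues hn ⟨0, hn0⟩ = ⟪u, A u⟫ := by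
    rw [hAu, real_inner_smul_right, real_inner_self_eq_norm_sq, hu1, one_pow, mul_one]
  have h2 : ⟪u, A u⟫ = ⟪u - Q u, T (u - Q u)⟫ := by
    rw [hAeq, ← hPs]
  have htop0 : 0 ≤ hT.eigenvalues hn ⟨0, hn0⟩ := by
    set x := hT.eigenvectorBasis hn ⟨0, hn0⟩
    have hx : T x = (hT.eigenvalues hn ⟨0, hn0⟩) • x := hT.apply_eigenvectorBasis hn ⟨0, hn0⟩
    have hx1 : ‖x‖ = 1 := (hT.eigenvectorBasis hn).orthonormal.1 ⟨0, hn0⟩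
    have h := hpos x
    rw [hx, real_inner_smul_right, real_inner_self_eq_norm_sq, hx1, one_pow, mul_one] at h
    exact h
  have hPn : ‖u - Q u‖ ^ 2 ≤ ‖u‖ ^ 2 := norm_ker_sq_le hQs hQi u
  rw [h1, h2]
  refine (inner_le_top_eigenvalue hn hn0 hT _).trans ?_
  calc hT.eigenvalues hn ⟨0, hn0⟩ * ‖u - Q u‖ ^ 2 ≤ hT.eigenvalues hn ⟨0, hn0⟩ * ‖u‖ ^ 2 :=
        mul_le_mul_of_nonneg_left hPn htop0
    _ = hT.eigenvalues hn ⟨0, hn0⟩ := by rw [hu1, one_pow, mul_one]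

/-- **The x2r bound for the top eigenvalue (spectral form).**  See the module docstring: the eigenpair of `T` and the top
eigenvector of the kept block required by `x2r_upper_bound_of_enclosure` are supplied by the spectral theorem, the bound on
the rest of the kept block by the one-sided Rayleigh bound at index `1`, and the sign of `u₀` is chosen inside.
[cite: Saad1992, Ch. III Thm 3.8] -/
theorem x2r_eigenvalue_bound (hn : finrank ℝ E = n) (hn1 : 1 < n) {T Q A : E →ₗ[ℝ] E} (hT : T.IsSymmetric)
    (hpos : ∀ z : E, 0 ≤ ⟪z, T z⟫) (hQs : ∀ x y : E, ⟪Q x, y⟫ = ⟪x, Q y⟫) (hQi : ∀ x : E, Q (Q x) = Q x)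
    (hA : A.IsSymmetric) (hAeq : ∀ a : E, A a = T (a - Q a) - Q (T (a - Q a)))
    {ε ℓ Λ ℓ₁ μlo μup ρ r X γ η : ℝ} {v : E} (hε : 0 ≤ ε)
    (hD : ∀ y : E, ⟪Q y, T (Q y)⟫ ≤ ε * ‖Q y‖ ^ 2) (hεℓ : ε < ℓ) (hℓ : ℓ ≤ hT.eigenvalues hn ⟨0, by omega⟩)
    (hΛ : ∀ a : E, Q a = 0 → ⟪a, T a⟫ ≤ Λ * ‖a‖ ^ 2) (hℓ₁0 : 0 ≤ ℓ₁)
    (hℓ₁ : hA.eigenvalues hn ⟨1, hn1⟩ ≤ ℓ₁)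
    (hlo : μlo ≤ hA.eigenvalues hn ⟨0, by omega⟩) (hup : hA.eigenvalues hn ⟨0, by omega⟩ ≤ μup)
    (hv : ‖v‖ = 1) (hQv : Q v = 0) (hρ : ρ = ⟪v, T v⟫) (hρℓ₁ : ℓ₁ < ρ) (hr : r = ‖T v - Q (T v) - ρ • v‖)
    (hX : X = ‖Q (T v)‖) (hγ : γ = ε * Λ / (ℓ - ε)) (hη : η = Real.sqrt 2 * r / (ρ - ℓ₁)) (hden : 0 < μlo - ℓ₁ - γ) :
    hT.eigenvalues hn ⟨0, by omega⟩ ≤ μup + (X + Real.sqrt (ε * Λ) * η) ^ 2 / (ℓ - ε) * (1 + γ / (μlo - ℓ₁ - γ)) := by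
  have hTs : ∀ x y : E, ⟪T x, y⟫ = ⟪x, T y⟫ := hT
  have hAapp : ∀ a : E, A a = T (a - Q a) - Q (T (a - Q a)) := hAeq
  -- the eigenpair of T at the top
  set i0 : Fin n := ⟨0, by omega⟩ with hi0
  set x := hT.eigenvectorBasis hn i0 with hxdef
  have hx : T x = (hT.eigenvalues hn i0) • x := hT.apply_eigenvectorBasis hn i0
  have hx1 : ‖x‖ = 1 := (hT.eigenvectorBasis hn).orthonormal.1 i0
  have hx0 : x ≠ 0 := by
    intro h; rw [h, norm_zero] at hx1; exact zero_ne_one hx1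
  -- the top eigenvector of the kept block A
  set u := hA.eigenvectorBasis hn i0 with hudef
  set μ₀ := hA.eigenvalues hn i0 with hμ₀def
  have hAu : A u = μ₀ • u := hA.apply_eigenvectorBasis hn i0
  have hu1 : ‖u‖ = 1 := (hA.eigenvectorBasis hn).orthonormal.1 i0
  have hγ0 : 0 ≤ γ := by
    have hΛ0 : 0 ≤ Λ := by
      have h1 := hΛ v hQv; have h2 := hpos v; rw [hv, one_pow, mul_one] at h1; linarith
    rw [hγ]; exact div_nonneg (mul_nonneg hε hΛ0) (sub_pos.mpr hεℓ).le
  have hμ₀pos : 0 < μ₀ := by linarith [hlo, hden, hℓ₁0, hγ0]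
  -- u lies in ker Q: u = μ₀⁻¹ A u and Q A = 0
  have hQA : ∀ a : E, Q (A a) = 0 := by
    intro a; rw [hAapp, map_sub, hQi, sub_self]
  have hQu : Q u = 0 := by
    have h : Q (A u) = μ₀ • Q u := by rw [hAu, map_smul]
    rw [hQA] at h
    exact (smul_eq_zero.mp h.symm).resolve_left hμ₀pos.ne'
  have hAu' : T u - Q (T u) = μ₀ • u := by
    have h := hAu; rwa [hAapp, hQu, sub_zero] at h
  -- the rest of the kept block is ⪯ ℓ₁ on u^⊥ ∩ ker Q
  have hℓ₁' : ∀ y : E, Q y = 0 → ⟪u, y⟫ = 0 → ⟪y, T y⟫ ≤ ℓ₁ * ‖y‖ ^ 2 := by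
    intro y hQy huy
    have hyA : ⟪y, T y⟫ = ⟪A y, y⟫ := by
      rw [hAapp, hQy, sub_zero, inner_sub_left, real_inner_comm, hQs, hQy, inner_zero_right, sub_zero]
    have hcf := re_inner_apply_self_le_of_inner_eq_zero hA hn ⟨1, hn1⟩ (x := y) (by
      intro i hi
      have hi' : i = i0 := by
        apply Fin.ext; rw [hi0]; simp only
        have : (i : ℕ) < 1 := hi
        omega
      rw [hi', ← hudef, huy])
    rw [RCLike.re_to_real] at hcf
    rw [hyA]
    exact hcf.trans (mul_le_mul_of_nonneg_right hℓ₁ (sq_nonneg _))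
  -- sign choice
  have key : ∀ u₀ : E, ‖u₀‖ = 1 → Q u₀ = 0 → T u₀ - Q (T u₀) = μ₀ • u₀ →
      (∀ y : E, Q y = 0 → ⟪u₀, y⟫ = 0 → ⟪y, T y⟫ ≤ ℓ₁ * ‖y‖ ^ 2) → 0 ≤ ⟪u₀, v⟫ →
      hT.eigenvalues hn i0 ≤ μup + (X + Real.sqrt (ε * Λ) * η) ^ 2 / (ℓ - ε) * (1 + γ / (μlo - ℓ₁ - γ)) :=
    fun u₀ hu0 hQu0 hAu0 hℓ₁0' hsign =>
      x2r_upper_bound_of_enclosure hTs hpos hQs hQi hε hD hx hx0 hεℓ hℓ hΛ hu0 hQu0 hAu0 hℓ₁0 hℓ₁0' hv hQv hsign hρ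
        hρℓ₁ hr hX hγ hη hlo hup hden
  rcases le_or_gt 0 ⟪u, v⟫ with hs | hs
  · exact key u hu1 hQu hAu' hℓ₁' hs
  · refine key (-u) (by rw [norm_neg, hu1]) (by rw [map_neg, hQu, neg_zero])
      (by rw [map_neg, map_neg, smul_neg, ← hAu']; abel) ?_ ?_
    · intro y hQy huy
      exact hℓ₁' y hQy (by rw [inner_neg_left] at huy; linarith)
    · rw [inner_neg_left]; linarith

end SecondOrderTail

end Summit.Ventures.YMGap.FlowData
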